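import Literature.Computability.FineGrained.Sweep1
import Literature.Computability.Complexity.CircuitSemantics
import Literature.Computability.Complexity.CircuitLightCone
import HarnessLib

/-!
# Fine-grained complexity, sweep 1: depth-two exact threshold circuits as sums of equality tests

The combinatorial half of R. Williams' win-win theorem (*The Orthogonal Vectors Conjecture and
Non-Uniform Circuit Lower Bounds*, FOCS 2024; full version ECCC TR24-142), formalised for the
circuit model of `Literature.Computability.FineGrained.Sweep1` (`IsEThr2Circuit`,
`readOnceTwoDNF`, `HasEThr2CircuitOfSize`):

* `EThr2.AffTest k`: an *affine equality test* `[cu + Σ_s wu_s x_s = cv + Σ_s wv_s y_s]` on a pair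
  `(x, y)` of `k`-bit vectors — the "equality matrix" defined by an exact threshold gate reading
  the `2k` input bits (loc. cit., proof of Thm. 2: `u[x] = Σ_j α_j x_j`, `v[y] = t - Σ_j β_j y_j`);
* `EThr2.normalForm` (**Williams' Theorem 2**, ECCC TR24-142, §2, p. 5, for our circuits, whose top
  gate may also read input wires): a depth-two exact threshold circuit `C` on the `2k` inputs
  computes `z ↦ [Σ_ω W_ω · E_ω(x, y) = t]` for integer weights `W` and affine equality tests `E_ω`
  indexed by the `2k + |C|` wires;
* `EThr2.PosRep k r lam` and `EThr2.exists_posRep` (Thm. 2 combined with the sum-of-squares trick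
  of Thm. 10, loc. cit. §3, p. 10): if `C` computes the read-once 2-DNF `⋁ᵢ (xᵢ ∧ yᵢ)`, then
  `N := Σ_ω W_ω E_ω - t` vanishes exactly on the non-disjoint pairs, and `P := N²`, expanded, is a
  combination of `r = 2^ρ ≤ 2 (|C| + 2k + 2)²` affine equality tests (pairs of tests are merged into
  one test `u₁ + M u₂ = v₁ + M v₂`, digits shifted into `[0, 2^lam)`), with `P ≥ 0` everywhere and
  `P > 0` exactly on the disjoint pairs — a *positive weak equality-rank representation* of the
  disjointness matrix `DISJ_k` (loc. cit., §1, "weak equality rank").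

These are the ingredients of the OV algorithm of `…FineGrained.Sweep1Proofs` (Williams' Thm. 3).

## References

* R. Williams, *The Orthogonal Vectors Conjecture and Non-Uniform Circuit Lower Bounds*,
  FOCS 2024, doi:10.1109/focs61266.2024.00088; full version ECCC TR24-142 (2024), Thm. 2 (p. 5),
  Thm. 8 (p. 6), Thm. 10 (p. 10).
-/

namespace Literature.Computability.FineGrained

open Finset Complexity

namespace EThr2

/-! ### Pairs of bit vectors, disjointness -/

variable {k : ℕ}

/-- The input `z : Fin 2 × Fin k → Bool` with `z (0, i) = x i` and `z (1, i) = y i`. [folklore] -/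
def pairInput (x y : Fin k → Bool) : Fin 2 × Fin k → Bool :=
  fun p => if p.1 = 0 then x p.2 else y p.2

/-- `pairInput` on an `x`-wire. [folklore] -/
@[simp] theorem pairInput_zero (x y : Fin k → Bool) (i : Fin k) : pairInput x y (0, i) = x i := rfl

/-- `pairInput` on a `y`-wire. [folklore] -/
@[simp] theorem pairInput_one (x y : Fin k → Bool) (i : Fin k) : pairInput x y (1, i) = y i := rfl

/-- `x` and `y` are *disjoint* (orthogonal): no coordinate carries two ones; the entry
`DISJ_k[x, y]` of the disjointness matrix (Williams, ECCC TR24-142, §1). [cite: FOCS2024, §1 (The Setup)] -/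
def Disj (x y : Fin k → Bool) : Prop := ∀ i, ¬ (x i = true ∧ y i = true)

/-- Disjointness of bit vectors is decidable. [folklore] -/
instance (x y : Fin k → Bool) : Decidable (Disj x y) :=
  inferInstanceAs (Decidable (∀ i, ¬ (x i = true ∧ y i = true)))

/-- The read-once 2-DNF is the complement of disjointness (Boolean Inner Product = `¬ DISJ`). [folklore] -/
theorem readOnceTwoDNF_pairInput (x y : Fin k → Bool) :
    readOnceTwoDNF k (pairInput x y) = decide (¬ Disj x y) := by
  rw [Bool.eq_iff_iff]
  simp [readOnceTwoDNF, Disj]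

/-! ### Affine equality tests -/

/-- An *affine equality test* on pairs of `k`-bit vectors: the Boolean matrix
`E[x, y] = [cu + Σ_s wu_s x_s = cv + Σ_s wv_s y_s]`, an equality matrix with affine defining
vectors (Williams, ECCC TR24-142, proof of Thm. 2, p. 5). [cite: FOCS2024, Thm. 2 (proof)] -/
structure AffTest (k : ℕ) where
  /-- Constant term of the row side. -/
  cu : ℤ
  /-- Weights of the row bits `x_s`. -/
  wu : Fin k → ℤ
  /-- Constant term of the column side. -/
  cv : ℤ
  /-- Weights of the column bits `y_s`. -/
  wv : Fin k → ℤ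

namespace AffTest

/-- The row value `u[x] = cu + Σ_s wu_s x_s`. [cite: FOCS2024, Thm. 2 (proof)] -/
def u (T : AffTest k) (x : Fin k → Bool) : ℤ := T.cu + ∑ s, if x s then T.wu s else 0

/-- The column value `v[y] = cv + Σ_s wv_s y_s`. [cite: FOCS2024, Thm. 2 (proof)] -/
def v (T : AffTest k) (y : Fin k → Bool) : ℤ := T.cv + ∑ s, if y s then T.wv s else 0

/-- The test holds at `(x, y)` iff `u[x] = v[y]`. [cite: FOCS2024, Thm. 2 (proof)] -/
def Holds (T : AffTest k) (x y : Fin k → Bool) : Prop := T.u x = T.v y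

/-- Whether a test holds is decidable (an equality of integers). [folklore] -/
instance (T : AffTest k) (x y : Fin k → Bool) : Decidable (T.Holds x y) :=
  inferInstanceAs (Decidable (T.u x = T.v y))

/-- The trivial test `[0 = 0]` (the all-ones matrix `J`). [folklore] -/
def triv : AffTest k := ⟨0, fun _ => 0, 0, fun _ => 0⟩

/-- The trivial test always holds. [folklore] -/
@[simp] theorem triv_holds (x y : Fin k → Bool) : (triv : AffTest k).Holds x y := by
  simp [Holds, u, v, triv]

/-- The test `[x_s = 1]`. [folklore] -/
def inX (s : Fin k) : AffTest k := ⟨0, fun s' => if s' = s then 1 else 0, 1, fun _ => 0⟩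

/-- The test `[1 = y_s]`. [folklore] -/
def inY (s : Fin k) : AffTest k := ⟨1, fun _ => 0, 0, fun s' => if s' = s then 1 else 0⟩

/-- A sum selecting one coordinate. [folklore] -/
private theorem sum_ite_ite_eq (z : Fin k → Bool) (s : Fin k) :
    (∑ s', if z s' = true then (if s' = s then (1 : ℤ) else 0) else 0) =
      if z s = true then 1 else 0 := by
  rw [Finset.sum_eq_single s (fun b _ hb => by simp [hb]) (by simp)]
  simp

/-- `[x_s = 1]` holds iff `x_s`. [folklore] -/
@[simp] theorem inX_holds (s : Fin k) (x y : Fin k → Bool) : (inX s).Holds x y ↔ x s = true := by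
  simp only [Holds, u, v, inX, sum_ite_ite_eq, zero_add]
  cases x s <;> simp

/-- `[1 = y_s]` holds iff `y_s`. [folklore] -/
@[simp] theorem inY_holds (s : Fin k) (x y : Fin k → Bool) : (inY s).Holds x y ↔ y s = true := by
  simp only [Holds, u, v, inY, sum_ite_ite_eq, zero_add]
  cases y s <;> simp

/-- The test of an input wire: `[x_s = 1]` for `(0, s)`, `[1 = y_s]` for `(1, s)`. [folklore] -/
def ofInput (p : Fin 2 × Fin k) : AffTest k := if p.1 = 0 then inX p.2 else inY p.2

/-- The input test holds iff the wire carries `1`. [folklore] -/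
theorem ofInput_holds (p : Fin 2 × Fin k) (x y : Fin k → Bool) :
    (ofInput p).Holds x y ↔ pairInput x y p = true := by
  obtain ⟨c, s⟩ := p
  unfold ofInput pairInput
  by_cases hc : c = 0
  · simp [hc]
  · simp [hc]

/-- The test of an exact threshold gate `[Σ_b w_b · z(args b) = t]` all of whose arguments are
input wires: `u[x] = Σ_{b : args b = x_s} w_b x_s`, `v[y] = t - Σ_{b : args b = y_s} w_b y_s`
(Williams, ECCC TR24-142, proof of Thm. 2). [cite: FOCS2024, Thm. 2 (proof)] -/
def ofGate {a : ℕ} (w : Fin a → ℤ) (t : ℤ) (args : Fin a → (Fin 2 × Fin k) ⊕ ℕ) : AffTest k :=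
  ⟨0, fun s => ∑ b, if args b = .inl (0, s) then w b else 0,
   t, fun s => -∑ b, if args b = .inl (1, s) then w b else 0⟩

/-- One summand of a gate reading only inputs, split over the `x`- and `y`-wires. [folklore] -/
private theorem summand_split {a : ℕ} (w : Fin a → ℤ) (args : Fin a → (Fin 2 × Fin k) ⊕ ℕ)
    (val : (Fin 2 × Fin k) ⊕ ℕ → Bool) (x y : Fin k → Bool)
    (hval : ∀ p, val (.inl p) = pairInput x y p) (b : Fin a) (hb : (args b).isLeft = true) :
    (if val (args b) = true then w b else 0) =
      (∑ s, if x s = true then (if args b = .inl (0, s) then w b else 0) else 0) +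
      ∑ s, if y s = true then (if args b = .inl (1, s) then w b else 0) else 0 := by
  obtain ⟨⟨c, s₀⟩, hp⟩ : ∃ p, args b = .inl p := Sum.isLeft_iff.mp hb
  rw [hp, hval]
  have h2 : ∀ c' : Fin 2, c' = 0 ∨ c' = 1 := by decide
  rcases h2 c with rfl | rfl
  · rw [Finset.sum_eq_single s₀ (fun s _ hs => by simp [Ne.symm hs]) (by simp),
      Finset.sum_eq_zero (fun s _ => by simp)]
    simp
  · rw [Finset.sum_eq_zero (fun s _ => by simp),
      Finset.sum_eq_single s₀ (fun s _ hs => by simp [Ne.symm hs]) (by simp)]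
    simp

/-- **The equality matrix of a bottom gate.** If all arguments of the exact threshold gate are
input wires, the gate fires at `z = (x, y)` iff the test `ofGate` holds (Williams, ECCC TR24-142,
proof of Thm. 2: "the matrix `M_{g_i}` is an equality matrix"). [cite: FOCS2024, Thm. 2 (proof)] -/
theorem ofGate_holds {a : ℕ} (w : Fin a → ℤ) (t : ℤ) (args : Fin a → (Fin 2 × Fin k) ⊕ ℕ)
    (val : (Fin 2 × Fin k) ⊕ ℕ → Bool) (x y : Fin k → Bool)
    (hargs : ∀ b, (args b).isLeft = true) (hval : ∀ p, val (.inl p) = pairInput x y p) :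
    (ofGate w t args).Holds x y ↔ (∑ b, if val (args b) = true then w b else 0) = t := by
  have hA : (∑ b, ∑ s, if x s = true then (if args b = .inl (0, s) then w b else 0) else 0) =
      ∑ s, if x s = true then (∑ b, if args b = .inl (0, s) then w b else 0) else 0 := by
    rw [Finset.sum_comm]
    refine Finset.sum_congr rfl (fun s _ => ?_)
    split_ifs <;> simp
  have hB : (∑ b, ∑ s, if y s = true then (if args b = .inl (1, s) then w b else 0) else 0) =
      ∑ s, if y s = true then (∑ b, if args b = .inl (1, s) then w b else 0) else 0 := by
    rw [Finset.sum_comm]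
    refine Finset.sum_congr rfl (fun s _ => ?_)
    split_ifs <;> simp
  have hsum : (∑ b, if val (args b) = true then w b else 0) =
      (∑ s, if x s = true then (∑ b, if args b = .inl (0, s) then w b else 0) else 0) +
      ∑ s, if y s = true then (∑ b, if args b = .inl (1, s) then w b else 0) else 0 := by
    rw [Finset.sum_congr rfl (fun b _ => summand_split w args val x y hval b (hargs b)),
      Finset.sum_add_distrib, hA, hB]
  rw [hsum]
  simp only [Holds, u, v, ofGate, zero_add]
  have hneg : ∀ s, (if y s = true then -∑ b, (if args b = .inl (1, s) then w b else 0) else 0) =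
      -(if y s = true then ∑ b, (if args b = .inl (1, s) then w b else 0) else 0) := by
    intro s; split_ifs <;> simp
  simp only [hneg, Finset.sum_neg_distrib]
  constructor
  · intro h; linarith
  · intro h; linarith

end AffTest

/-! ### Exact threshold gates and the shape of depth-two circuits -/

/-- A gate from the basis `ETHR` has integer weights and a threshold. [folklore] -/
theorem exists_weights {ι : Type*} {g : Gate ι} (hg : g.fn ∈ exactThrBasis) :
    ∃ (w : Fin g.arity → ℤ) (t : ℤ), ∀ v, g.op v = decide ((∑ i, if v i then w i else 0) = t) := by
  obtain ⟨k', w, t, h⟩ := hg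
  obtain ⟨a, op, args⟩ := g
  simp only [Gate.fn, exactThrGate, Sigma.mk.inj_iff] at h
  obtain ⟨rfl, h2⟩ := h
  exact ⟨w, t, fun v => congrFun (eq_of_heq h2) v⟩

section depths

variable {ι : Type*}

open GateList

/-- Every gate has depth at least `1`. [folklore] -/
theorem one_le_getD_depths (gs : List (Gate ι)) :
    ∀ m, m < gs.length → 1 ≤ (depths gs).getD m 0 := by
  induction gs using List.reverseRecOn with
  | nil => intro m hm; simp at hm
  | append_singleton gs g ih =>
    intro m hm
    rw [depths_append_singleton]
    rcases lt_or_ge m gs.length with h | h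
    · rw [List.getD_append _ _ _ _ (by simpa using h)]; exact ih m h
    · have hm' : m = gs.length := by simp at hm; omega
      subst hm'
      rw [List.getD_append_right _ _ _ _ (by simp), show gs.length - (depths gs).length = 0 by simp,
        List.getD_cons_zero]
      simp only [depthOf]
      exact Nat.le_add_right 1 _

/-- **The shape of shallow gates.** In a well-formed program, a gate of depth `≤ 1` reads only
input wires, and a gate of depth `≤ 2` reads only input wires and gates that read only input
wires. [folklore] -/
theorem isLeft_of_depths_le (gs : List (Gate ι)) (hwf : WF gs) :
    (∀ (j : ℕ) (g : Gate ι), gs[j]? = some g → (depths gs).getD j 0 ≤ 1 →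
      ∀ a, (g.args a).isLeft = true) ∧
    (∀ (j : ℕ) (g : Gate ι), gs[j]? = some g → (depths gs).getD j 0 ≤ 2 →
      ∀ a m, g.args a = .inr m → ∃ g', gs[m]? = some g' ∧ ∀ b, (g'.args b).isLeft = true) := by
  induction gs using List.reverseRecOn with
  | nil => exact ⟨fun j g h => by simp at h, fun j g h => by simp at h⟩
  | append_singleton gs g ih =>
    obtain ⟨ih1, ih2⟩ := ih hwf.of_append_left
    have hlast : GateOK gs.length g := hwf.getLast
    -- the depth entry of the new gate
    have hnew : (depths (gs ++ [g])).getD gs.length 0 = depthOf (depths gs) g := by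
      rw [depths_append_singleton, List.getD_append_right _ _ _ _ (by simp),
        show gs.length - (depths gs).length = 0 by simp, List.getD_cons_zero]
    have hold : ∀ j, j < gs.length → (depths (gs ++ [g])).getD j 0 = (depths gs).getD j 0 := by
      intro j hj
      rw [depths_append_singleton, List.getD_append _ _ _ _ (by simpa using hj)]
    -- bound on the depth of a gate read by `g`
    have harg : ∀ d, depthOf (depths gs) g ≤ d + 1 → ∀ a m, g.args a = .inr m →
        (depths gs).getD m 0 ≤ d := by
      intro d hd a m ha
      simp only [depthOf] at hd
      rw [Nat.add_comm d 1] at hd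
      have := (Finset.sup_le_iff.1 (Nat.le_of_add_le_add_left hd)) a (Finset.mem_univ a)
      simp only [ha] at this
      exact this
    refine ⟨fun j g' hj hdj a => ?_, fun j g' hj hdj a m ha => ?_⟩
    · rcases lt_or_ge j gs.length with h | h
      · rw [List.getElem?_append_left h] at hj
        exact ih1 j g' hj ((hold j h) ▸ hdj) a
      · obtain rfl : j = gs.length := by
          have := (List.getElem?_eq_some_iff.1 hj).1; simp at this; omega
        have hg' : g' = g := by simpa using hj.symm
        subst hg'
        rw [hnew] at hdj
        cases ha : g'.args a with
        | inl p => rfl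
        | inr m =>
          exfalso
          have h0 : (depths gs).getD m 0 ≤ 0 := harg 0 hdj a m ha
          have h1 : 1 ≤ (depths gs).getD m 0 := one_le_getD_depths gs m (hlast a m ha)
          omega
    · rcases lt_or_ge j gs.length with h | h
      · rw [List.getElem?_append_left h] at hj
        obtain ⟨g'', hm, hb⟩ := ih2 j g' hj ((hold j h) ▸ hdj) a m ha
        exact ⟨g'', by rw [List.getElem?_append_left (List.getElem?_eq_some_iff.1 hm).1]; exact hm,
          hb⟩
      · obtain rfl : j = gs.length := by
          have := (List.getElem?_eq_some_iff.1 hj).1; simp at this; omega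
        have hg' : g' = g := by simpa using hj.symm
        subst hg'
        rw [hnew] at hdj
        have hm : m < gs.length := hlast a m ha
        have hdm : (depths gs).getD m 0 ≤ 1 := harg 1 hdj a m ha
        refine ⟨gs[m], by rw [List.getElem?_append_left hm]; exact List.getElem?_eq_getElem hm,
          ih1 m _ (List.getElem?_eq_getElem hm) hdm⟩

end depths

/-! ### Williams' Theorem 2: the normal form of a depth-two exact threshold circuit -/

/-- The wires of a circuit with `n` gates on the `2k` inputs: input wires and gates. [folklore] -/
abbrev Wire (k n : ℕ) : Type := (Fin 2 × Fin k) ⊕ Fin n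

/-- A wire as a reference of the straight-line program. [folklore] -/
def Wire.toRef {n : ℕ} : Wire k n → (Fin 2 × Fin k) ⊕ ℕ := Sum.map id Fin.val

/-- `Wire.toRef` is injective. [folklore] -/
theorem Wire.toRef_injective {n : ℕ} : Function.Injective (Wire.toRef (k := k) (n := n)) :=
  Sum.map_injective.2 ⟨fun _ _ h => h, Fin.val_injective⟩

/-- Merging repeated wires: a weighted sum over the argument positions of a gate is a weighted
sum over the (distinct) wires, each wire weighted by the total weight of the positions reading
it. [folklore] -/
private theorem sum_merge {α β R : Type*} [Fintype α] [Fintype β] [DecidableEq β] [DecidableEq R]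
    (e : β → R) (he : Function.Injective e) (args : α → R) (hrange : ∀ a, ∃ b, e b = args a)
    (P : R → Prop) [DecidablePred P] (w : α → ℤ) :
    (∑ b, if P (e b) then (∑ a, if args a = e b then w a else 0) else 0) =
      ∑ a, if P (args a) then w a else 0 := by
  calc (∑ b, if P (e b) then (∑ a, if args a = e b then w a else 0) else 0)
      = ∑ b, ∑ a, (if P (e b) then (if args a = e b then w a else 0) else 0) := by
        refine Finset.sum_congr rfl (fun b _ => ?_)
        split_ifs <;> simp
    _ = ∑ a, ∑ b, (if P (e b) then (if args a = e b then w a else 0) else 0) := Finset.sum_comm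
    _ = ∑ a, if P (args a) then w a else 0 := by
        refine Finset.sum_congr rfl (fun a _ => ?_)
        obtain ⟨b₀, hb₀⟩ := hrange a
        rw [Finset.sum_eq_single b₀ (fun b _ hb => ?_) (by simp), hb₀, if_pos rfl]
        have : args a ≠ e b := fun h => hb (he (h.symm.trans hb₀.symm))
        rw [if_neg this, ite_self]

/-- **Williams' Theorem 2** (ECCC TR24-142, §2, p. 5, proof: every bottom exact threshold gate
is an equality matrix, the top gate tests a weighted sum of them against its threshold), in the
circuit model of `Sweep1` (the top gate may also read input wires, which are the equality
matrices `[x_s = 1]`, `[1 = y_s]`; repeated wires are merged by summing their weights): a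
depth-two circuit over `ETHR` with `n` gates on the inputs `(x, y) ∈ {0,1}^k × {0,1}^k` computes
`[Σ_ω W_ω · E_ω(x, y) = t]` for integer weights `W` indexed by the `2k + n` wires, an integer
`t`, and affine equality tests `E_ω`. [cite: FOCS2024, Thm. 2] -/
theorem normalForm (C : Circuit (Fin 2 × Fin k)) (hC : IsEThr2Circuit C) :
    ∃ (W : Wire k C.size → ℤ) (t : ℤ) (T : Wire k C.size → AffTest k),
      ∀ x y, C.eval (pairInput x y) =
        decide ((∑ ω, if (T ω).Holds x y then W ω else 0) = t) := by
  obtain ⟨hover, hdepth⟩ := hC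
  have hw : ∀ g ∈ C.gates, ∃ (w : Fin g.arity → ℤ) (t : ℤ),
      ∀ v, g.op v = decide ((∑ i, if v i then w i else 0) = t) :=
    fun g hg => exists_weights (hover g hg)
  choose! wt tt hwt using hw
  -- the test attached to a program reference
  let testRef : (Fin 2 × Fin k) ⊕ ℕ → AffTest k := fun ω => match ω with
    | .inl p => AffTest.ofInput p
    | .inr m => if h : m < C.gates.length then
        AffTest.ofGate (wt C.gates[m]) (tt C.gates[m]) (C.gates[m]).args else AffTest.triv
  let T : Wire k C.size → AffTest k := fun ω => testRef ω.toRef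
  cases ho : C.output with
  | inl p =>
    refine ⟨fun ω => if ω = .inl p then 1 else 0, 1, T, fun x y => ?_⟩
    show C.eval (pairInput x y) = decide ((∑ ω, if (T ω).Holds x y then
      (if ω = Sum.inl p then (1 : ℤ) else 0) else 0) = 1)
    rw [eval_eq_wireVal, ho, Finset.sum_eq_single (Sum.inl p : Wire k C.size)
      (fun ω _ hω => by rw [if_neg hω, ite_self]) (by simp), if_pos rfl]
    simp only [wireVal]
    have hT : (T (.inl p)).Holds x y ↔ pairInput x y p = true := AffTest.ofInput_holds p x y
    by_cases hp : pairInput x y p = true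
    · rw [hp, if_pos (hT.2 hp)]; decide
    · rw [if_neg (fun h => hp (hT.1 h))]
      simp only [Bool.not_eq_true] at hp
      rw [hp]; decide
  | inr m =>
    have hm : m < C.gates.length := C.wf_output m ho
    -- the structural consequences of depth `≤ 2`
    have hDm : (GateList.depths C.gates).getD m 0 ≤ 2 := by
      have : C.depth = (GateList.depths C.gates).getD m 0 := by
        unfold Circuit.depth Circuit.depthWith
        rw [ho, GateList.circuit_depthVals_one]
      rw [← this]; exact hdepth
    obtain ⟨-, hstruct⟩ := isLeft_of_depths_le C.gates (GateList.wf_gates C)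
    have hgm : C.gates[m]? = some C.gates[m] := List.getElem?_eq_getElem hm
    -- the value of every wire read by the top gate
    have hwire : ∀ x y (a : Fin (C.gates[m]).arity),
        wireVal (pairInput x y) (transcript (pairInput x y) [] C.gates) ((C.gates[m]).args a) =
          decide ((testRef ((C.gates[m]).args a)).Holds x y) := by
      intro x y a
      cases ha : (C.gates[m]).args a with
      | inl p =>
        simp only [wireVal, testRef]
        rw [Bool.eq_iff_iff, decide_eq_true_iff]
        exact (AffTest.ofInput_holds p x y).symm
      | inr m' =>
        obtain ⟨g', hg', hleft⟩ := hstruct m _ hgm hDm a m' ha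
        obtain ⟨hm', rfl⟩ := List.getElem?_eq_some_iff.1 hg'
        simp only [wireVal, testRef, dif_pos hm']
        rw [getD_transcript_eq_gateValue C (pairInput x y) m' hm', gateValue,
          hwt _ (List.getElem_mem hm'), decide_eq_decide]
        exact (AffTest.ofGate_holds _ _ _ (wireVal (pairInput x y)
          (transcript (pairInput x y) [] C.gates)) x y hleft (fun p => rfl)).symm
    -- merge repeated wires
    have hrange : ∀ a : Fin (C.gates[m]).arity, ∃ ω : Wire k C.size,
        ω.toRef = (C.gates[m]).args a := by
      intro a
      cases ha : (C.gates[m]).args a with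
      | inl p => exact ⟨.inl p, rfl⟩
      | inr m' =>
        have : m' < C.gates.length := (C.wf m hm a m' ha).trans hm
        exact ⟨.inr ⟨m', this⟩, rfl⟩
    refine ⟨fun ω => ∑ a, if (C.gates[m]).args a = ω.toRef then wt C.gates[m] a else 0,
      tt C.gates[m], T, fun x y => ?_⟩
    rw [eval_eq_wireVal, ho]
    simp only [wireVal]
    rw [getD_transcript_eq_gateValue C (pairInput x y) m hm, gateValue,
      hwt _ (List.getElem_mem hm),
      sum_merge Wire.toRef Wire.toRef_injective _ hrange (fun r => (testRef r).Holds x y)]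
    congr 2
    refine Finset.sum_congr rfl (fun a _ => ?_)
    rw [hwire x y a]
    simp only [decide_eq_true_eq]

/-! ### Shifting and pairing affine tests -/

namespace AffTest

/-- A bound on the row and column values: `|cu| + Σ|wu| + |cv| + Σ|wv|`. [folklore] -/
def norm (T : AffTest k) : ℤ := |T.cu| + ∑ s, |T.wu s| + (|T.cv| + ∑ s, |T.wv s|)

/-- The bound is nonnegative. [folklore] -/
theorem norm_nonneg (T : AffTest k) : 0 ≤ T.norm := by
  unfold norm; positivity

/-- Row values are bounded by `norm`. [folklore] -/
theorem abs_u_le (T : AffTest k) (x : Fin k → Bool) : |T.u x| ≤ T.norm := by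
  have h1 : |∑ s, (if x s = true then T.wu s else 0)| ≤ ∑ s, |T.wu s| :=
    (Finset.abs_sum_le_sum_abs _ _).trans (Finset.sum_le_sum fun s _ => by split_ifs <;> simp)
  have h2 : (0 : ℤ) ≤ |T.cv| + ∑ s, |T.wv s| := by positivity
  unfold u norm
  exact (abs_add_le _ _).trans (by linarith)

/-- Column values are bounded by `norm`. [folklore] -/
theorem abs_v_le (T : AffTest k) (y : Fin k → Bool) : |T.v y| ≤ T.norm := by
  have h1 : |∑ s, (if y s = true then T.wv s else 0)| ≤ ∑ s, |T.wv s| :=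
    (Finset.abs_sum_le_sum_abs _ _).trans (Finset.sum_le_sum fun s _ => by split_ifs <;> simp)
  have h2 : (0 : ℤ) ≤ |T.cu| + ∑ s, |T.wu s| := by positivity
  unfold v norm
  exact (abs_add_le _ _).trans (by linarith)

/-- Shift both sides of a test by `K` (same matrix, values moved by `K`). [folklore] -/
def shift (T : AffTest k) (K : ℤ) : AffTest k := ⟨T.cu + K, T.wu, T.cv + K, T.wv⟩

/-- Row values of a shifted test. [folklore] -/
@[simp] theorem u_shift (T : AffTest k) (K : ℤ) (x : Fin k → Bool) :
    (T.shift K).u x = T.u x + K := by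
  simp only [u, shift]; ring

/-- Column values of a shifted test. [folklore] -/
@[simp] theorem v_shift (T : AffTest k) (K : ℤ) (y : Fin k → Bool) :
    (T.shift K).v y = T.v y + K := by
  simp only [v, shift]; ring

/-- Shifting does not change the matrix. [folklore] -/
@[simp] theorem shift_holds (T : AffTest k) (K : ℤ) (x y : Fin k → Bool) :
    (T.shift K).Holds x y ↔ T.Holds x y := by
  simp only [Holds, u_shift, v_shift, add_left_inj]

/-- The pairing of two tests in base `M`: `u = u₁ + M u₂`, `v = v₁ + M v₂` — the equality matrix
of the pair of defining vectors (Williams, ECCC TR24-142, proof of Thm. 10: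
`U^{(k,k')}[i] = (u^{(k)}[i], u^{(k')}[i])`). [cite: FOCS2024, Thm. 10 (proof)] -/
def pair (T₁ T₂ : AffTest k) (M : ℤ) : AffTest k :=
  ⟨T₁.cu + M * T₂.cu, fun s => T₁.wu s + M * T₂.wu s, T₁.cv + M * T₂.cv, fun s => T₁.wv s + M * T₂.wv s⟩

/-- A sum of selected sums splits. [folklore] -/
private theorem sum_ite_add_mul (z : Fin k → Bool) (a b : Fin k → ℤ) (M : ℤ) :
    (∑ s, if z s = true then a s + M * b s else 0) =
      (∑ s, if z s = true then a s else 0) + M * ∑ s, (if z s = true then b s else 0) := by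
  rw [Finset.mul_sum, ← Finset.sum_add_distrib]
  refine Finset.sum_congr rfl (fun s _ => ?_)
  split_ifs <;> ring

/-- Row values of a paired test. [folklore] -/
@[simp] theorem u_pair (T₁ T₂ : AffTest k) (M : ℤ) (x : Fin k → Bool) :
    (T₁.pair T₂ M).u x = T₁.u x + M * T₂.u x := by
  simp only [u, pair, sum_ite_add_mul]; ring

/-- Column values of a paired test. [folklore] -/
@[simp] theorem v_pair (T₁ T₂ : AffTest k) (M : ℤ) (y : Fin k → Bool) :
    (T₁.pair T₂ M).v y = T₁.v y + M * T₂.v y := by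
  simp only [v, pair, sum_ite_add_mul]; ring

/-- **The paired test is the conjunction** when the digits of the first test are in `[0, M)`
(uniqueness of base-`M` digits). [cite: FOCS2024, Thm. 10 (proof)] -/
theorem pair_holds {T₁ T₂ : AffTest k} {M : ℤ} {x y : Fin k → Bool}
    (hu : 0 ≤ T₁.u x ∧ T₁.u x < M) (hv : 0 ≤ T₁.v y ∧ T₁.v y < M) :
    (T₁.pair T₂ M).Holds x y ↔ T₁.Holds x y ∧ T₂.Holds x y := by
  simp only [Holds, u_pair, v_pair]
  constructor
  · intro h
    have hM : (0 : ℤ) < M := by omega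
    have h2 : T₂.u x = T₂.v y := by
      by_contra hne
      rcases lt_or_gt_of_ne hne with hlt | hgt
      · have h3 : M * (T₂.u x + 1) ≤ M * T₂.v y := mul_le_mul_of_nonneg_left (by omega) hM.le
        rw [mul_add, mul_one] at h3
        linarith
      · have h3 : M * (T₂.v y + 1) ≤ M * T₂.u x := mul_le_mul_of_nonneg_left (by omega) hM.le
        rw [mul_add, mul_one] at h3
        linarith
    rw [h2] at h
    exact ⟨by linarith, h2⟩
  · rintro ⟨h1, h2⟩
    rw [h1, h2]

end AffTest

/-! ### Positive representations of the disjointness matrix -/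

/-- A *positive weak equality-rank representation* of the disjointness matrix `DISJ_k` by `r`
affine equality tests with digits below `2^lam`: integer coefficients `α_ℓ` and tests `E_ℓ`
such that `P(x, y) := Σ_ℓ α_ℓ E_ℓ(x, y)` is `≥ 0` everywhere and `> 0` exactly on the disjoint
pairs (a weak representation in the sense of Williams, ECCC TR24-142, §1 — same zero pattern as
`DISJ_k` — made nonnegative by the sum-of-squares trick of Thm. 10), all of whose row and column
values `u_ℓ[x]`, `v_ℓ[y]` lie in `[0, 2^lam)`. [cite: FOCS2024, §1 (weak equality rank), Thm. 10] -/
structure PosRep (k r lam : ℕ) where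
  /-- The coefficients. -/
  α : Fin r → ℤ
  /-- The affine equality tests. -/
  test : Fin r → AffTest k
  /-- `P ≥ 0`. -/
  nonneg : ∀ x y, 0 ≤ ∑ ℓ, if (test ℓ).Holds x y then α ℓ else 0
  /-- `P > 0` exactly on the disjoint pairs. -/
  pos_iff : ∀ x y, (0 < ∑ ℓ, if (test ℓ).Holds x y then α ℓ else 0) ↔ Disj x y
  /-- Row digits lie in `[0, 2^lam)`. -/
  u_range : ∀ ℓ x, 0 ≤ (test ℓ).u x ∧ (test ℓ).u x < 2 ^ lam
  /-- Column digits lie in `[0, 2^lam)`. -/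
  v_range : ∀ ℓ y, 0 ≤ (test ℓ).v y ∧ (test ℓ).v y < 2 ^ lam

/-- Re-indexing a family of weighted tests along an embedding into `Fin r` (padding with
zero-weight trivial tests) does not change `P`. [folklore] -/
private theorem sum_embed {β : Type*} [Fintype β] [DecidableEq β] {r : ℕ} (e : β ↪ Fin r)
    (A : β → ℤ) (PT : β → AffTest k) (x y : Fin k → Bool) :
    (∑ ℓ : Fin r, if (if h : ∃ p, e p = ℓ then PT h.choose else AffTest.triv).Holds x y then
        (if h : ∃ p, e p = ℓ then A h.choose else 0) else 0) =
      ∑ p, if (PT p).Holds x y then A p else 0 := by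
  classical
  rw [← Finset.sum_subset (Finset.subset_univ (Finset.univ.map e)), Finset.sum_map]
  · refine Finset.sum_congr rfl (fun p _ => ?_)
    have h : ∃ p', e p' = e p := ⟨p, rfl⟩
    have hc : h.choose = p := e.injective h.choose_spec
    simp only [dif_pos h, hc]
  · intro ℓ _ hℓ
    have h : ¬ ∃ p, e p = ℓ := fun ⟨p, hp⟩ => hℓ (Finset.mem_map.2 ⟨p, Finset.mem_univ _, hp⟩)
    simp only [dif_neg h, ite_self]

/-- **A subexponential `ETHR ∘ ETHR` circuit for Boolean Inner Product yields a small positive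
representation of `DISJ`** (Williams, ECCC TR24-142: Thm. 2, p. 5, with the sum-of-squares step
of Thm. 10, p. 10). If `C` is a depth-two exact threshold circuit with `n` gates computing the
read-once 2-DNF on `2k` variables, then `DISJ_k` has a positive weak equality-rank
representation by `r = 2^ρ ≤ 2 (n + 2k + 2)²` affine equality tests: with the normal form
`[Σ_ω W_ω E_ω = t]` of `C` (`normalForm`), `N := Σ_ω W_ω E_ω - t·J` vanishes exactly where the
2-DNF is true, i.e. off the disjoint pairs, and `N² = Σ_{ω,ω'} W_ω W_ω' (E_ω ∧ E_ω')`, where the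
conjunction of two equality tests is the equality test of the paired vectors. [cite: FOCS2024, Thm. 2, Thm. 10] -/
theorem exists_posRep (C : Circuit (Fin 2 × Fin k)) (hC : IsEThr2Circuit C)
    (hf : C.Computes (readOnceTwoDNF k)) :
    ∃ ρ lam : ℕ, 2 ^ ρ ≤ 2 * (C.size + 2 * k + 2) ^ 2 ∧ Nonempty (PosRep k (2 ^ ρ) lam) := by
  classical
  obtain ⟨W, t, T, hW⟩ := normalForm C hC
  -- `N = Σ W E - t J`, indexed by `Option (Wire k n)`
  let W' : Option (Wire k C.size) → ℤ := fun o => o.elim (-t) W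
  let T' : Option (Wire k C.size) → AffTest k := fun o => o.elim AffTest.triv T
  have hN : ∀ x y, (∑ o, if (T' o).Holds x y then W' o else 0) =
      (∑ ω, if (T ω).Holds x y then W ω else 0) - t := by
    intro x y
    rw [Fintype.sum_option]
    simp only [W', T', Option.elim_none, Option.elim_some, AffTest.triv_holds, if_true]
    ring
  have hN0 : ∀ x y, (∑ o, if (T' o).Holds x y then W' o else 0) = 0 ↔ ¬ Disj x y := by
    intro x y
    have h := hW x y
    rw [hf, readOnceTwoDNF_pairInput, decide_eq_decide] at h
    rw [hN, sub_eq_zero]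
    exact h.symm
  -- shift the digits into `[0, 2K]`
  let K : ℤ := ∑ o, (T' o).norm
  have hK : ∀ o, (T' o).norm ≤ K := fun o =>
    Finset.single_le_sum (fun o _ => (T' o).norm_nonneg) (Finset.mem_univ o)
  let M : ℤ := 2 * K + 1
  let S : Option (Wire k C.size) → AffTest k := fun o => (T' o).shift K
  have hSu : ∀ o x, 0 ≤ (S o).u x ∧ (S o).u x < M := by
    intro o x
    have := abs_le.1 (((T' o).abs_u_le x).trans (hK o))
    simp only [S, AffTest.u_shift, M]
    omega
  have hSv : ∀ o y, 0 ≤ (S o).v y ∧ (S o).v y < M := by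
    intro o y
    have := abs_le.1 (((T' o).abs_v_le y).trans (hK o))
    simp only [S, AffTest.v_shift, M]
    omega
  -- pairs of tests: `N²`
  let PT : Option (Wire k C.size) × Option (Wire k C.size) → AffTest k :=
    fun p => (S p.1).pair (S p.2) M
  let A : Option (Wire k C.size) × Option (Wire k C.size) → ℤ := fun p => W' p.1 * W' p.2
  have hPT : ∀ p x y, (PT p).Holds x y ↔ (T' p.1).Holds x y ∧ (T' p.2).Holds x y := by
    intro p x y
    rw [AffTest.pair_holds (hSu p.1 x) (hSv p.1 y)]
    simp only [S, AffTest.shift_holds]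
  have hP : ∀ x y, (∑ p, if (PT p).Holds x y then A p else 0) =
      (∑ o, if (T' o).Holds x y then W' o else 0) ^ 2 := by
    intro x y
    rw [sq, Finset.sum_mul_sum, Fintype.sum_prod_type]
    refine Finset.sum_congr rfl (fun a _ => Finset.sum_congr rfl (fun b _ => ?_))
    rw [if_congr (hPT (a, b) x y) rfl rfl]
    by_cases h1 : (T' a).Holds x y <;> by_cases h2 : (T' b).Holds x y <;> simp [h1, h2, A]
  have hPTu : ∀ p x, 0 ≤ (PT p).u x ∧ (PT p).u x < M * M := by
    intro p x
    obtain ⟨h1, h2⟩ := hSu p.1 x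
    obtain ⟨h3, h4⟩ := hSu p.2 x
    simp only [PT, AffTest.u_pair]
    have h5 : M * (S p.2).u x ≤ M * (M - 1) := mul_le_mul_of_nonneg_left (by omega) (by omega)
    constructor <;> nlinarith
  have hPTv : ∀ p y, 0 ≤ (PT p).v y ∧ (PT p).v y < M * M := by
    intro p y
    obtain ⟨h1, h2⟩ := hSv p.1 y
    obtain ⟨h3, h4⟩ := hSv p.2 y
    simp only [PT, AffTest.v_pair]
    have h5 : M * (S p.2).v y ≤ M * (M - 1) := mul_le_mul_of_nonneg_left (by omega) (by omega)
    constructor <;> nlinarith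
  -- digit size `lam` and number of terms `2^ρ`
  let lam : ℕ := (M * M).toNat
  have hlam : (M * M : ℤ) < 2 ^ lam := by
    have h0 : (0 : ℤ) ≤ M * M := mul_self_nonneg M
    have : ((M * M).toNat : ℤ) = M * M := Int.toNat_of_nonneg h0
    calc (M * M : ℤ) = (lam : ℤ) := this.symm
      _ < ((2 ^ lam : ℕ) : ℤ) := by exact_mod_cast Nat.lt_two_pow_self
      _ = 2 ^ lam := by push_cast; ring
  let r₀ : ℕ := Fintype.card (Option (Wire k C.size) × Option (Wire k C.size))
  have hr₀ : r₀ = (2 * k + C.size + 1) ^ 2 := by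
    simp only [r₀, Fintype.card_prod, Fintype.card_option, Fintype.card_sum, Fintype.card_fin]
    ring
  let ρ : ℕ := Nat.log 2 r₀ + 1
  have hρ : r₀ < 2 ^ ρ := Nat.lt_pow_succ_log_self (by norm_num) r₀
  have hρ' : 2 ^ ρ ≤ 2 * (C.size + 2 * k + 2) ^ 2 := by
    have h1 : 2 ^ Nat.log 2 r₀ ≤ r₀ := Nat.pow_log_le_self 2 (by rw [hr₀]; positivity)
    have h2 : r₀ ≤ (C.size + 2 * k + 2) ^ 2 := by
      rw [hr₀]; exact Nat.pow_le_pow_left (by omega) 2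
    calc 2 ^ ρ = 2 * 2 ^ Nat.log 2 r₀ := by rw [pow_succ]; ring
      _ ≤ 2 * (C.size + 2 * k + 2) ^ 2 := by omega
  obtain ⟨e⟩ : Nonempty (Option (Wire k C.size) × Option (Wire k C.size) ↪ Fin (2 ^ ρ)) :=
    Function.Embedding.nonempty_of_card_le (by rw [Fintype.card_fin]; exact hρ.le)
  refine ⟨ρ, lam, hρ', ⟨{
    α := fun ℓ => if h : ∃ p, e p = ℓ then A h.choose else 0
    test := fun ℓ => if h : ∃ p, e p = ℓ then PT h.choose else AffTest.triv
    nonneg := fun x y => ?_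
    pos_iff := fun x y => ?_
    u_range := fun ℓ x => ?_
    v_range := fun ℓ y => ?_ }⟩⟩
  · rw [sum_embed e A PT x y, hP]; positivity
  · rw [sum_embed e A PT x y, hP, sq_pos_iff, Ne, hN0, not_not]
  · by_cases h : ∃ p, e p = ℓ
    · simp only [dif_pos h]
      obtain ⟨h1, h2⟩ := hPTu h.choose x
      exact ⟨h1, h2.trans hlam⟩
    · simp only [dif_neg h, AffTest.u, AffTest.triv, Finset.sum_const_zero, ite_self, add_zero]
      exact ⟨le_rfl, by positivity⟩
  · by_cases h : ∃ p, e p = ℓ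
    · simp only [dif_pos h]
      obtain ⟨h1, h2⟩ := hPTv h.choose y
      exact ⟨h1, h2.trans hlam⟩
    · simp only [dif_neg h, AffTest.v, AffTest.triv, Finset.sum_const_zero, ite_self, add_zero]
      exact ⟨le_rfl, by positivity⟩

/-- The same from the size predicate of `Sweep1`: a depth-two exact threshold circuit of size
`≤ s` for the read-once 2-DNF on `2k` variables gives a positive representation of `DISJ_k` by
`2^ρ ≤ 2 (s + 2k + 2)²` tests. [cite: FOCS2024, Thm. 2, Thm. 10] -/
theorem exists_posRep_of_hasEThr2CircuitOfSize {s : ℝ} (h : HasEThr2CircuitOfSize k s) :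
    ∃ ρ lam : ℕ, (2 : ℝ) ^ ρ ≤ 2 * (s + 2 * k + 2) ^ 2 ∧ Nonempty (PosRep k (2 ^ ρ) lam) := by
  obtain ⟨C, hC, hs, hf⟩ := h
  obtain ⟨ρ, lam, hρ, hrep⟩ := exists_posRep C hC hf
  refine ⟨ρ, lam, ?_, hrep⟩
  have h1 : ((C.size : ℝ) + 2 * k + 2) ^ 2 ≤ (s + 2 * k + 2) ^ 2 := by gcongr
  calc (2 : ℝ) ^ ρ = ((2 ^ ρ : ℕ) : ℝ) := by push_cast; ring
    _ ≤ ((2 * (C.size + 2 * k + 2) ^ 2 : ℕ) : ℝ) := by exact_mod_cast hρ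
    _ = 2 * ((C.size : ℝ) + 2 * k + 2) ^ 2 := by push_cast; ring
    _ ≤ 2 * (s + 2 * k + 2) ^ 2 := by linarith

end EThr2

end Literature.Computability.FineGrained
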